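import Summits.AtomisticToContinuum.BoseEinsteinCondensation.Theorems.BECDispersionLadderEndpointTransfer
import Literature.MathematicalPhysics.QuantumManyBody.PeriodicMaxFormBoundHardCore
import HarnessLib

/-!
# `EndpointTransfer` holds

Closing file for the support statement `EndpointTransfer` of the route `BECDispersionLadder`
(`Summit.AtomisticToContinuum.BoseEinsteinCondensation.Theses.BECDispersionLadder.EndpointTransfer`): condensation at
every fractional dispersion exponent `α ∈ (α₀, 2)` transfers to the endpoint `α = 2` (quadratic dispersion). The
reduction `EndpointTransfer.endpointTransfer_of_maxFormBound` (`BECDispersionLadderEndpointTransfer.lean`: dial comparison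
`E_α ≤ E_2 + (2-α)N`, continuity of the truncated ground-state energies, momentum truncation of near-minimisers) left
exactly one hypothesis, the maximal-form bound **MaxFormBound** for hard-core pair potentials, which is now the
Literature theorem `maxFormBound_of_isRepulsiveFiniteRange` (`PeriodicMaxFormBoundHardCore.lean`: the periodic Bose
`C¹` core is a form core of the maximal form also when `v(|·|) ∉ L¹_loc` — ACL representatives along coordinate lines,
vanishing at transversal hard crossings, Hardy layer decay `o(s²)`, symmetric plateau cut-offs, B. Simon's `L¹_loc`
theorem for the softened profile).
-/

noncomputable section

namespace Summit.AtomisticToContinuum.BoseEinsteinCondensation.Theorems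

open Literature.MathematicalPhysics.QuantumManyBody.BoseGas

/-- **`EndpointTransfer` (route `BECDispersionLadder`) holds unconditionally**: the reduction
`endpointTransfer_of_maxFormBound` fed with MaxFormBound for hard-core pair potentials
(`maxFormBound_of_isRepulsiveFiniteRange`). -/
theorem endpointTransfer_proof :
    Summit.AtomisticToContinuum.BoseEinsteinCondensation.Theses.BECDispersionLadder.EndpointTransfer :=
  EndpointTransfer.endpointTransfer_of_maxFormBound maxFormBound_of_isRepulsiveFiniteRange

end Summit.AtomisticToContinuum.BoseEinsteinCondensation.Theorems

end
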